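import Summits.ResolutionOfSingularities.ResolutionOfSingularities.Theorems.FrobeniusClosingSteerSwitchBinaryOddSatelliteRun
import Summits.ResolutionOfSingularities.ResolutionOfSingularities.Theorems.FrobeniusClosingSteerBinaryResidueExceptionalTwice
import HarnessLib

/-!
# hARᵒ H2 — Fβʳᵘⁿ: **the same exceptional parameter at two consecutive visits is followed by an A-STAGE** (run level; the alternation
# `A B A B …` of H2-DESIGN §5 (Fβ)) — Theses-free, def-free

OURS (campaign `res-hironaka`, rung L ★L-G4, slot W4.1 · crux `Steer` (stmt-ResolutionOfSingularities-16345) · hARᵒ slot H2; P0 brief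
`L/res-L0-w41-plan-1/P0-BRIEF-hARo.md` b66a17a38113b83f §«Remaining objects» 4; design res-type-062 g15 `H2-DESIGN.md` 7dac75913b6b98e3 §5 (Fβ);
seat res-D-repro-2 g9, P0 main hand (res-L0-w41-plan-1 RULINGS 221(b)/249(d))). The run plumbing over res-D-lib-2's three-member contradiction
`BinaryResidue.false_of_exceptional_twice` (p554639) — exactly the plumbing of F3ʳᵘⁿ `binaryAStage_of_oddSatellite_run` (p556495; windows both in the
`x`-chart, no satellite). Not a statement of the manuscript under review [claim: Hironaka2017, status: under-review]; AI-produced, weaker than expert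
review.

INPUTS: steered run at `p = 2`, characteristic `2`, `R 0` dominated by `O`, regular members of dimension `4`; visit pairs `(j₁, j₂)`, `(j₂, N)`; `j₁` an
A-stage of reduced order `d ≥ 3`; `x` an exceptional parameter of BOTH point steps `j₁` and `j₂`, Hγ along `x` on both gaps; reduced order `d` at
`j₂` and at `N` (S1b); N4's height-one clause at `j₂` and `N`; rational windows in value form (Q1 binders). OUTPUT: `IsAStageAt R P s 2 N d` —
after a B-visit at which `x` is STILL exceptional the next visit is an A-stage (the B-case `ν_N = d + 1` of `HasReducedOrderAt` is the
contradiction of p554639). [cite: Matsumura1987, Thm. 14.2] [folklore]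
-/

noncomputable section

-- `Summit.<S>.<S>.…` duplicates the summit name by design (single-problem summit).
set_option linter.dupNamespace false

open IsLocalRing MvPolynomial

namespace Summit.ResolutionOfSingularities.ResolutionOfSingularities.Theorems.SwitchingDichotomy.BinaryResidue

open Literature.AlgebraicGeometry.Resolution
open Summit.ResolutionOfSingularities.ResolutionOfSingularities.Theorems.SwitchingDichotomy.Words
  (HasClordAlongAt HasCleanedOrderAt HasReducedOrderAt IsOddDivisorAt NoOddDivisorAt IsAStageAt IsSteeredRun IsVisitPair IsPointStep)

variable {K : Type} [Field K] {O : ValuationSubring K} {R : ℕ → Subring K} {P : (i : ℕ) → Ideal (R i)} {t : K} {s : ℕ → K}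

/-- **Fβʳᵘⁿ — the SAME exceptional parameter at two consecutive visits is followed by an A-STAGE (run level).** Steered run at `p = 2`
in characteristic `2` (`R 0` dominated by `O`), regular members of dimension `4`; visit pairs `(j₁, j₂)`, `(j₂, N)`; `j₁` an A-stage of
reduced order `d ≥ 3`; `x` an exceptional parameter of BOTH point steps `j₁` and `j₂` (Hγ along `x` on both gaps); reduced order `d` at `j₂` and
at `N`; N4's height-one clause at `j₂` and `N`; rational windows (value form). Then the visit `N` is again an A-STAGE of reduced order `d`
(lib-2's three-member contradiction `BinaryResidue.false_of_exceptional_twice`, p554639, excludes `ν_N = d + 1`). COROLLARY (H2-DESIGN §5 (Fβ)):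
along `[A, j₁]` the visits alternate `A B A B …`. [cite: Matsumura1987, Thm. 14.2] [folklore] -/
theorem aStage_of_exceptional_twice_run [CharP K 2] (hrun : IsSteeredRun O R P t 2 s) (hR0 : SubringDominates (R 0) O.toSubring)
    (hreg : ∀ i, IsRegularLocalRing (R i)) (hdim : ∀ i, ringKrullDim (R i) = (4 : ℕ))
    {j₁ j₂ N : ℕ} (hv₁ : IsVisitPair R P j₁ j₂) (hv₂ : IsVisitPair R P j₂ N)
    {d : ℕ} (hd : 3 ≤ d) (hA : IsAStageAt R P s 2 j₁ d)
    (hredj₂ : HasReducedOrderAt R s 2 j₂ d) (hredN : HasReducedOrderAt R s 2 N d)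
    {x : K} (hx : (∃ h : x ∈ R j₁, (⟨x, h⟩ : R j₁) ∈ P j₁) ∧ x ≠ 0 ∧ ∀ y : R j₁, y ∈ P j₁ → O.valuation (y : K) ≤ O.valuation x)
    (Hγ₁ : ∀ k, j₁ < k → k < j₂ → ∃ hx : x ∈ R k, P k = Ideal.span {(⟨x, hx⟩ : R k)})
    (hx' : (∃ h : x ∈ R j₂, (⟨x, h⟩ : R j₂) ∈ P j₂) ∧ x ≠ 0 ∧ ∀ y : R j₂, y ∈ P j₂ → O.valuation (y : K) ≤ O.valuation x)
    (Hγ₂ : ∀ k, j₂ < k → k < N → ∃ hx : x ∈ R k, P k = Ideal.span {(⟨x, hx⟩ : R k)})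
    (h1j₂ : ∀ (hs' : s j₂ ^ 2 ∈ R j₂) (Q : Ideal (R j₂)) [Q.IsPrime], Q.height = 1 →
      ¬ SigmaTopLegality.IsSingPrime (R j₂) 2 ⟨s j₂ ^ 2, hs'⟩ Q)
    (h1N : ∀ (hs' : s N ^ 2 ∈ R N) (Q : Ideal (R N)) [Q.IsPrime], Q.height = 1 →
      ¬ SigmaTopLegality.IsSingPrime (R N) 2 ⟨s N ^ 2, hs'⟩ Q)
    (hrat₁ : ∀ a ∈ R j₂, ∃ b ∈ R j₁, O.valuation (a - b) < 1)
    (hrat₂ : ∀ a ∈ R N, ∃ b ∈ R j₂, O.valuation (a - b) < 1) :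
    IsAStageAt R P s 2 N d := by
  classical
  -- members are local, regular domains, dominated by `O`
  haveI hloc : ∀ i, IsLocalRing (R i) := fun i => VisitLawPointStep.isLocalRing_of_run hrun i
  have hdom : ∀ i, SubringDominates (R i) O.toSubring := fun i => VisitLawPointStep.subringDominates_of_run hrun hR0 i
  have hbl : ∀ i, IsLocalBlowupAlong O (R i) (P i) (R (i + 1)) := fun i => VisitLawPointStep.isLocalBlowupAlong_of_run hrun i
  obtain ⟨hpt₁, -, hdodd, hclean₁⟩ := hA
  have h2d : 2 ≤ d := by omega
  -- visit law at (j₁, j₂): ring constancy and the unit-cofactor law with `ν = d`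
  obtain ⟨⟨hRj₂, G, W, hG, hW, hWinv, hW0, hlaw⟩, -, hclord⟩ :=
    VisitLawDelta.visitLaw₂_of_run hrun hR0 hv₁ hx Hγ₁ hreg h1j₂ h2d hclean₁
  -- point steps
  obtain ⟨instj₁, hPj₁⟩ := hpt₁
  obtain ⟨instj₂, hPj₂⟩ := hv₁.2.2.1
  have hpt₂ : IsPointStep R P j₂ := hv₁.2.2.1
  -- `x` at `j₁ + 1`: regular parameter
  have hx1 : x ∈ R (j₁ + 1) := (hbl j₁).isLocalBlowup.le hx.1.fst
  obtain ⟨hxm₁, hx2₁, -⟩ := VisitLawPointStep.prime_excParam_succ hrun hR0 ⟨instj₁, hPj₁⟩ (hreg j₁) (hreg (j₁ + 1)) hx hx1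
  -- `x` is an odd divisor at `j₂` (clord `d % 2 = 1`), hence `ν_{j₂} = d + 1`
  have hd2 : d % 2 = 1 := Nat.odd_iff.mp hdodd
  rw [hd2] at hclord
  have hodd₂ : IsOddDivisorAt R s 2 j₂ x := by
    have key : ∀ (S : Subring K) (hS : S = R (j₁ + 1)) (hxS : x ∈ S) [IsLocalRing S],
        (⟨x, hxS⟩ : S) ∈ maximalIdeal S ∧ (⟨x, hxS⟩ : S) ∉ maximalIdeal S ^ 2 := by
      intro S hS hxS _; subst hS; exact ⟨hxm₁, hx2₁⟩
    obtain ⟨hm, hm2⟩ := key (R j₂) hRj₂ (hRj₂ ▸ hx1)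
    exact ⟨hloc j₂, hRj₂ ▸ hx1, hm, hm2, 1, odd_one, hclord⟩
  have hν₂ : HasCleanedOrderAt R s 2 j₂ (d + 1) := by
    obtain ⟨ν, hν, hcase⟩ := hredj₂
    rcases hcase with ⟨hno, -⟩ | ⟨-, hdν⟩
    · exact absurd hodd₂ (hno x)
    · rw [hdν]; exact hν
  -- visit law at (j₂, N) with `ν = d + 1`, along `x` again
  have h2d1 : 2 ≤ d + 1 := by omega
  obtain ⟨⟨hRN, G₁, W₁, hG₁, hW₁, hW₁inv, hW₁0, hlaw₂⟩, -, -⟩ :=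
    VisitLawDelta.visitLaw₂_of_run hrun hR0 hv₂ hx' Hγ₂ hreg h1N h2d1 hν₂
  -- the three members `S₀ = R j₁ ≤ S₁ = R (j₁+1) (= R j₂) ≤ S₂ = R (j₂+1) (= R N)`
  have h01 : R j₁ ≤ R (j₁ + 1) := (hbl j₁).isLocalBlowup.le
  have h12 : R (j₁ + 1) ≤ R (j₂ + 1) := hRj₂ ▸ (hbl j₂).isLocalBlowup.le
  haveI := hreg j₁; haveI := hreg (j₁ + 1); haveI := hreg (j₂ + 1)
  -- domination: maximal ideal = value < 1
  have hval : ∀ i (a : R i), a ∈ maximalIdeal (R i) ↔ O.valuation (a : K) < 1 := fun i =>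
    (subringDominates_valuationSubring_iff (hdom i).1).mp (hdom i)
  -- maximality of `x` at `j₂`, transported to `R (j₁+1)`
  have hxmaxv : ∀ y : K, y ∈ R (j₁ + 1) → O.valuation y < 1 → O.valuation y ≤ O.valuation x := by
    have h' : ∀ y : K, y ∈ R j₂ → O.valuation y < 1 → O.valuation y ≤ O.valuation x := by
      intro y hy hv
      have hm : (⟨y, hy⟩ : R j₂) ∈ maximalIdeal (R j₂) := (hval j₂ ⟨y, hy⟩).mpr hv
      exact hx'.2.2 ⟨y, hy⟩ (hPj₂ ▸ hm)
    rw [hRj₂] at h'; exact h'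
  have hxmax₁ : ∀ y : R (j₁ + 1), y ∈ maximalIdeal (R (j₁ + 1)) → O.valuation (y : K) ≤ O.valuation x :=
    fun y hy => hxmaxv y y.2 ((hval _ y).mp hy)
  -- the two quadratic transforms in chart form (both in the `x`-chart)
  have hbl₁ : IsLocalBlowupAlong O (R j₁) (maximalIdeal (R j₁)) (R (j₁ + 1)) := by
    have h := hbl j₁; rw [hPj₁] at h; exact h
  have hxm₀ : (⟨x, hx.1.fst⟩ : R j₁) ∈ maximalIdeal (R j₁) := hPj₁ ▸ hx.1.snd
  have hxmax₀ : ∀ y : R j₁, y ∈ maximalIdeal (R j₁) → O.valuation (y : K) ≤ O.valuation x :=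
    fun y hy => hx.2.2 y (hPj₁ ▸ hy)
  have hR₁ : R (j₁ + 1) = locAtCentre (blowupRing (R j₁) x) O :=
    DivisorTrigger.eq_locAtCentre_blowupRing hbl₁ hx.1.fst hxm₀ hx.2.1 hxmax₀
  have hbl₂ : IsLocalBlowupAlong O (R (j₁ + 1)) (maximalIdeal (R (j₁ + 1))) (R (j₂ + 1)) := by
    have key : ∀ (S : Subring K) (hS : S = R j₂) [IsLocalRing S], IsLocalBlowupAlong O S (maximalIdeal S) (R (j₂ + 1)) := by
      intro S hS _; subst hS
      have h := hbl j₂; rw [hPj₂] at h; exact h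
    exact key _ hRj₂.symm
  have hR₂ : R (j₂ + 1) = locAtCentre (blowupRing (R (j₁ + 1)) x) O :=
    DivisorTrigger.eq_locAtCentre_blowupRing hbl₂ hx1 hxm₁ hx.2.1 hxmax₁
  -- rationality in the tree's form
  have hrat₁' : ∀ a : R (j₁ + 1), ∃ b : R j₁, a - ⟨(b : K), h01 b.2⟩ ∈ maximalIdeal (R (j₁ + 1)) := by
    intro a
    have ha : (a : K) ∈ R j₂ := by rw [hRj₂]; exact a.2
    obtain ⟨b, hb, hvb⟩ := hrat₁ a ha
    exact ⟨⟨b, hb⟩, (hval _ _).mpr (by simpa using hvb)⟩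
  have hrat₂' : ∀ a : R (j₂ + 1), ∃ b : R (j₁ + 1), a - ⟨(b : K), h12 b.2⟩ ∈ maximalIdeal (R (j₂ + 1)) := by
    intro a
    have ha : (a : K) ∈ R N := by rw [hRN]; exact a.2
    obtain ⟨b, hb, hvb⟩ := hrat₂ a ha
    have hb' : b ∈ R (j₁ + 1) := by rw [← hRj₂]; exact hb
    exact ⟨⟨b, hb'⟩, (hval _ _).mpr (by simpa using hvb)⟩
  -- the windows (both along `x`)
  have hdim₀' : ringKrullDim (R j₁) = ((3 : ℕ) + 1 : ℕ) := by rw [hdim]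
  have hdim₁' : ringKrullDim (R (j₁ + 1)) = ((3 : ℕ) + 1 : ℕ) := by rw [hdim]
  have hdim₂' : ringKrullDim (R (j₂ + 1)) = ((3 : ℕ) + 1 : ℕ) := by rw [hdim]
  obtain ⟨u, u', hxu, hu, hm₁⟩ := exists_adapted_window (hdom j₁) (hdom (j₁ + 1)) hdim₀' ⟨x, hx.1.fst⟩ hxm₀ hx.2.1 hxmax₀
    hR₁ h01 hdim₁' hrat₁'
  obtain ⟨v, v', hxv, hv, hm₂⟩ := exists_adapted_window (hdom (j₁ + 1)) (hdom (j₂ + 1)) hdim₁' ⟨x, hx1⟩ hxm₁ hx.2.1 hxmax₁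
    hR₂ h12 hdim₂' hrat₂'
  -- characteristic 2
  have h2 : (2 : K) = 0 := CharTwo.two_eq_zero
  -- radicands as members
  obtain ⟨_, hs₁, ⟨G₀, hG₀⟩, hexact₀⟩ := hclean₁
  have hsj₂ : s j₂ ^ 2 ∈ R (j₁ + 1) := by rw [← hRj₂]; exact VisitLawPointStep.pow_mem_of_run hrun j₂
  have hGR : G ∈ R (j₁ + 1) := by rw [← hRj₂]; exact hG
  have hWR : W ∈ R (j₁ + 1) := by rw [← hRj₂]; exact hW
  have hsN : s N ^ 2 ∈ R (j₂ + 1) := by rw [← hRN]; exact VisitLawPointStep.pow_mem_of_run hrun N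
  have hG₁R : G₁ ∈ R (j₂ + 1) := by rw [← hRN]; exact hG₁
  have hW₁R : W₁ ∈ R (j₂ + 1) := by rw [← hRN]; exact hW₁
  set f₀ : R j₁ := ⟨s j₁ ^ 2, hs₁⟩ with hf₀
  set f₁ : R (j₁ + 1) := ⟨s j₂ ^ 2, hsj₂⟩ with hf₁
  set f₂ : R (j₂ + 1) := ⟨s N ^ 2, hsN⟩ with hf₂
  -- the squared laws (characteristic 2)
  set e := (d + 1) / 2 with he
  have hde : d + 1 = 2 * e := by omega
  have hlaw₁' : ((f₁ : R (j₁ + 1)) : K) * x ^ (d - 1) * ((⟨W, hWR⟩ : R (j₁ + 1)) : K) ^ 2 =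
      ((f₀ : R j₁) : K) - ((⟨G, hGR⟩ : R (j₁ + 1)) : K) ^ 2 := by
    have hm : d - 1 = 2 * (d / 2) := by omega
    have esq := congrArg (fun z : K => z ^ 2) hlaw
    show s j₂ ^ 2 * x ^ (d - 1) * W ^ 2 = s j₁ ^ 2 - G ^ 2
    rw [hm, pow_mul]
    linear_combination esq + (G ^ 2 - s j₁ * G) * h2
  have hlaw₂' : ((f₂ : R (j₂ + 1)) : K) * x ^ (d + 1) * ((⟨W₁, hW₁R⟩ : R (j₂ + 1)) : K) ^ 2 =
      ((f₁ : R (j₁ + 1)) : K) - ((⟨G₁, hG₁R⟩ : R (j₂ + 1)) : K) ^ 2 := by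
    have esq := congrArg (fun z : K => z ^ 2) hlaw₂
    show s N ^ 2 * x ^ (d + 1) * W₁ ^ 2 = s j₂ ^ 2 - G₁ ^ 2
    rw [hde, pow_mul]
    linear_combination esq + (G₁ ^ 2 - s j₂ * G₁) * h2
  -- cleaned order `d + 1` at `j₂`, read in `R (j₁ + 1)`
  have hclean₁' : ∃ γ₁ : R (j₁ + 1), f₁ - γ₁ ^ 2 ∈ maximalIdeal (R (j₁ + 1)) ^ (d + 1) := by
    obtain ⟨_, hs', ⟨γ₁, hγ₁⟩, -⟩ := hν₂
    have hγR : (γ₁ : K) ∈ R (j₁ + 1) := by rw [← hRj₂]; exact γ₁.2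
    refine ⟨⟨(γ₁ : K), hγR⟩, ?_⟩
    exact sub_sq_mem_pow_of_subring_eq hRj₂ (d + 1) (VisitLawPointStep.pow_mem_of_run hrun j₂) γ₁.2 hsj₂ hγR hγ₁
  -- the reduced order at `N` decides: the B-case `ν_N = d + 1` is excluded by Fβ
  obtain ⟨ν, hν, hcase⟩ := hredN
  rcases hcase with ⟨hno, hdν⟩ | ⟨-, hdν⟩
  · subst hdν
    exact ⟨hv₂.2.2.1, hno, hdodd, hν⟩
  · exfalso
    subst hdν
    have hclean₂' : ∃ γ₂ : R (j₂ + 1), f₂ - γ₂ ^ 2 ∈ maximalIdeal (R (j₂ + 1)) ^ (d + 1) := by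
      obtain ⟨_, hs', ⟨γ₂, hγ₂⟩, -⟩ := hν
      have hγR : (γ₂ : K) ∈ R (j₂ + 1) := by rw [← hRN]; exact γ₂.2
      refine ⟨⟨(γ₂ : K), hγR⟩, ?_⟩
      exact sub_sq_mem_pow_of_subring_eq hRN (d + 1) (VisitLawPointStep.pow_mem_of_run hrun N) γ₂.2 hsN hγR hγ₂
    exact false_of_exceptional_twice h2 (R j₁) (R (j₁ + 1)) (R (j₂ + 1)) h01 h12 (hreg _) (hreg _) (hdim _) (hdim _)
      ⟨x, hx.1.fst⟩ hx.2.1 u hxu u' hu hm₁ hrat₁' v hxv v' hv hm₂ hrat₂' hde f₀ G₀ hG₀ hexact₀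
      f₁ ⟨G, hGR⟩ ⟨W, hWR⟩ hlaw₁' hclean₁' f₂ ⟨G₁, hG₁R⟩ ⟨W₁, hW₁R⟩ hlaw₂' hclean₂'

end Summit.ResolutionOfSingularities.ResolutionOfSingularities.Theorems.SwitchingDichotomy.BinaryResidue

end
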